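import Summits.HodgeConjecture.HodgeConjecture.Theses.BoundaryReadout

/-!
# Line `kernel_descent` for the crux `BoundaryAbsoluteness` (stmt-HodgeConjecture-15913),
# route `BoundaryReadout` — the ARITHMETIC ⟂ TOPOLOGY cut (crux-strategist, 2026-08-17)

`BoundaryAbsoluteness`: for `f : 𝒳 ⟶ C` (𝒳 smooth projective of dimension `N`, `C` a smooth
projective curve, `f` surjective), `o ∈ C(ℂ)`, smooth projective `g_i : Y_i ⟶ X_o` jointly covering
the fibre, and a rational `(p,p)` class `ξ` on `𝒳` with every `ξ|Y_i` absolute Hodge, `ξ|X_t` is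
absolute Hodge on every smooth projective fibre `X_t`.

This skeleton records the coarsest honest decomposition of the crux — the typed split of the
strategy census (`STRATEGY-CENSUS.md`, § Decomposition) — as a registered two-stub line, so that
its topological half becomes a prover target TODAY:

* `stub_fibreKernelInclusion` (TOPOLOGY; theorem-candidate, chart-free, no Hodge classes, no
  `ℚ`-structure): on every conjugate `f^σ : 𝒳^σ ⟶ C^σ` of the crux's family, a complex class on `𝒳^σ`
  killed by all the conjugate covering pieces `Y_i^σ` of `X_o^σ` is killed by every smooth projective
  fibre `X_t^σ` — Hodge III Prop. 8.2.7 (PROVED in the tree: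
  `Deligne1974_ker_pullback_eq_ker_pullback_resolution_holds`, vanishing on an open `V ⊇ X_o^σ(ℂ)`),
  the tube lemma (`f^σ(ℂ)` proper), and local constancy of the vanishing of restricted global
  classes over the connected smooth locus of `C^σ` (`FibreRestrictionsLocallyConstantRank`,
  Ehresmann `ComplexPointsEhresmann`), which contains `t^σ` (`f` flat, `X_t` smooth). It is the
  common helper of `stub_boundaryReadout` (lines `birth`, `typewise_readout`) and `stub_typeReadout`
  (line `typewise_readout`), isolated.
* `stub_kernelDescent` (ARITHMETIC; curve-free): **absoluteness descends along conjugation-stable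
  kernel inclusions** — for morphisms `h_i : Y_i ⟶ X`, `w : W ⟶ X` of smooth projective varieties
  such that on EVERY conjugate `X^σ` a complex class killed by all `h_i^σ` is killed by `w^σ`, a Hodge
  class `ξ` on `X` with all `h_i^* ξ` absolute Hodge has `w^* ξ` absolute Hodge. Proof plan = the
  σ-package of the other lines (conjugates exist; conjugation natural) + rational lift along the
  pieces (finite-dimensionality, `exists_isRationalClass_complexBetti_map_eq` family version) +
  typewise descent (type projectors `HodgeModel.typeProj` commute with restrictions,
  `IsOfHodgeType.map_of_isSmoothProjective`): the untwisted conjugate `Θ` of `ξ` agrees on the pieces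
  with a rational class `θ₀` and, componentwise, with its `(p,p)`-part, so `Θ - θ₀` and the other
  type components lie in the kernel of all `h_i^σ`, hence of `w^σ`.
* `BoundaryAbsoluteness_of` — the composition (pure logic, kernel-checked, no `sorry`): apply
  `stub_kernelDescent` to `X = 𝒳`, `h_i = g_i ≫ ι_o`, `w = ι_t`, the kernel hypothesis being
  `stub_fibreKernelInclusion`.

Relation to the other registered lines: `birth` / `typewise_readout` cut the crux INSIDE the
arithmetic (conjugates exist · naturality · [`Fᵖ`-compatibility | type readout] · rational readout);
this line cuts it ACROSS (all arithmetic | all topology). `stub_kernelDescent` is NOT the crux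
reworded: it has no curve, no fibre, no covering hypothesis — the geometry is abstracted into the
kernel-inclusion hypothesis — and it is the statement a tenure planner can promote to a route-level
split (`route edit --split BoundaryAbsoluteness --into KernelDescent FibreKernelInclusion`, glue =
`BoundaryAbsoluteness_of` below). Disproof used: none on file (no `Disproof.lean`; negatives index:
nothing on absolute Hodge classes). Landed Negative lemmas (`Theorems/BallQuotientHodgeAbsolute/Negative/*`):
chart existence for `W` and single-valuedness of conjugation on `w^* ξ` are obligations INSIDE
`stub_kernelDescent` (its proof plan names them); rationality stays load-bearing (the descent
concludes rationality from rationality on the pieces). No stub is an instance they refute.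
-/

noncomputable section

namespace Summit.HodgeConjecture.HodgeConjecture.Cruxes.BoundaryAbsoluteness.KernelDescentLine

open CategoryTheory AlgebraicGeometry
open Literature.AlgebraicGeometry.Motives Literature.AlgebraicGeometry.HodgeTheory
open Summit.HodgeConjecture.HodgeConjecture.Theses.BoundaryReadout (BoundaryAbsoluteness)

/-! ### The two statements (named; the stubs assert them verbatim) -/

/-- STATEMENT 1 — **absoluteness descends along conjugation-stable kernel inclusions** (ARITHMETIC,
curve-free). For `h_i : Y_i ⟶ X` (finitely many) and `w : W ⟶ X`, all smooth projective, such that for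
every `σ ∈ Aut ℂ` and every degree `k`, `⋂ᵢ ker((h_i^σ)^*) ⊆ ker((w^σ)^*)` on `Hᵏ(X^σ(ℂ); ℂ)`: if `ξ` is a
rational `(p,p)` class on `X` whose pull-backs `h_i^* ξ` are absolute Hodge, then `w^* ξ` is absolute
Hodge. [cite: CharlesSchnell2014Notes, Def. 11.2.3 and §11.2.2] [cite: Deligne1982HodgeCycles, §2 Thm. 2.12]
[cite: VoisinHodgeI2002, §7.1.1 and §7.3.2] -/
def KernelDescent : Prop :=
  ∀ ⦃n : ℕ⦄ ⦃X : SchemeOver ℂ⦄, IsSmoothProjective n X →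
    ∀ ⦃ι : Type⦄ [Finite ι] ⦃m : ι → ℕ⦄ ⦃Y : ι → SchemeOver ℂ⦄ (h : ∀ i, Y i ⟶ X),
      (∀ i, IsSmoothProjective (m i) (Y i)) →
      ∀ ⦃nW : ℕ⦄ ⦃W : SchemeOver ℂ⦄ (w : W ⟶ X), IsSmoothProjective nW W →
        (∀ (σ : ℂ ≃+* ℂ) (k : ℕ) (x : complexBetti (conjugateVariety σ X) k),
          (∀ i, complexBetti.map (conjHom σ (h i)) k x = 0) →
            complexBetti.map (conjHom σ w) k x = 0) →
        ∀ (p : ℕ) (ξ : complexBetti X (2 * p)), IsRationalClass ξ → IsOfHodgeType n X (2 * p) p p ξ →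
          (∀ i, IsAbsoluteHodgeClass (m i) (Y i) p (complexBetti.map (h i) (2 * p) ξ)) →
          IsAbsoluteHodgeClass nW W p (complexBetti.map w (2 * p) ξ)

/-- STATEMENT 2 — **the fibre kernel inclusion** (TOPOLOGY; the vanishing readout): for the data of
the crux and every `σ ∈ Aut ℂ`, a class `x ∈ Hᵏ(𝒳^σ(ℂ); ℂ)` killed by all the conjugate covering pieces
`(g_i ≫ ι_o)^σ : Y_i^σ ⟶ 𝒳^σ` is killed by `ι_t^σ : X_t^σ ⟶ 𝒳^σ` for every `t` with `X_t` smooth projective.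
[cite: DeligneHodgeIII1974, Prop. 8.2.7 and Cor. 8.2.8] [cite: VoisinHodgeI2002, §9.2.1 and Thm. 9.3] -/
def FibreKernelInclusion : Prop :=
  ∀ ⦃N : ℕ⦄ ⦃𝒳 C : SchemeOver ℂ⦄ (f : 𝒳 ⟶ C) (o : AlgPoints C ℂ),
    IsSmoothProjective N 𝒳 → IsSmoothProjective 1 C → Function.Surjective f.left.base →
    ∀ ⦃ι : Type⦄ [Finite ι] ⦃m : ι → ℕ⦄ ⦃Y : ι → SchemeOver ℂ⦄ (g : ∀ i, Y i ⟶ fiberOver f o),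
      (∀ i, IsSmoothProjective (m i) (Y i)) →
      (∀ x : ↥(fiberOver f o).left, ∃ (i : ι) (y : ↥(Y i).left), (g i).left.base y = x) →
      ∀ (σ : ℂ ≃+* ℂ) (k : ℕ) (x : complexBetti (conjugateVariety σ 𝒳) k),
        (∀ i, complexBetti.map (conjHom σ (g i ≫ fiberι f o)) k x = 0) →
        ∀ (t : AlgPoints C ℂ) ⦃n : ℕ⦄, IsSmoothProjective n (fiberOver f t) →
          complexBetti.map (conjHom σ (fiberι f t)) k x = 0

/-! ### The two registered stubs (`sorry` only here) -/

/-- STUB 1 (ARITHMETIC — L/XL: contains the σ-infrastructure shared with `Lines/birth.lean` and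
`Lines/typewise_readout.lean`, i.e. their `stub_conjugate_exists` + `stub_conjugateNaturality`, plus the
rational lift along the pieces and the typewise descent, both `ℂ`-linear algebra on `X^σ` given those)
— **absoluteness descends along conjugation-stable kernel inclusions.** Why plausibly true: for a
conjugate `c'` of `w^* ξ`, name a conjugate `Ξ'` of `ξ` on `X^σ` and `Θ := (2πi/σ(2πi))^{-p} Ξ'`;
naturality identifies `c'` with `(w^σ)^* Ξ'` and the conjugates of `h_i^* ξ` with `(h_i^σ)^* Ξ'`, so by
hypothesis `(h_i^σ)^* Θ = β_i` is rational and `(p,p)`; a rational `θ₀` with the same restrictions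
exists (finite-dimensionality of `H(X^σ; ℚ)`), and `Θ - θ₀`, as well as the type components
`π_{(c,d)} Θ`, `(c,d) ≠ (p,p)` (type projectors of a Hodge model of `X^σ`), die on all pieces, hence —
KERNEL HYPOTHESIS — on `W^σ`; so `β := (w^σ)^* Θ = (w^σ)^* θ₀` is rational, `β = (w^σ)^* (π_{(p,p)} Θ)` is of
type `(p,p)`, and `c' = twist · β`. Why it might fail: only through the tree's chart carriers (existence and
single-valuedness of `IsConjugateClass` are theorems in print not yet in the tree: Jouanolou, GAGA,
Grothendieck comparison). Size: XL in total, L beyond the shared σ-stubs. Leans on: `IsConjugateClass`,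
`conjHom`, `periodTwist_ne_zero`, `exists_isRationalClass_complexBetti_map_eq`, `HodgeModel.typeProj`,
`IsOfHodgeType.map_of_isSmoothProjective`, `IsSmoothProjective.conjugateVariety_holds`.
[cite: CharlesSchnell2014Notes, §11.2.2 and Def. 11.2.3] [cite: Jouanolou1973, Lemme 1.5]
[cite: Grothendieck1966, Thm. 1'] [cite: VoisinHodgeI2002, §7.1.1] -/
theorem stub_kernelDescent :
    ∀ ⦃n : ℕ⦄ ⦃X : SchemeOver ℂ⦄, IsSmoothProjective n X →
      ∀ ⦃ι : Type⦄ [Finite ι] ⦃m : ι → ℕ⦄ ⦃Y : ι → SchemeOver ℂ⦄ (h : ∀ i, Y i ⟶ X),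
        (∀ i, IsSmoothProjective (m i) (Y i)) →
        ∀ ⦃nW : ℕ⦄ ⦃W : SchemeOver ℂ⦄ (w : W ⟶ X), IsSmoothProjective nW W →
          (∀ (σ : ℂ ≃+* ℂ) (k : ℕ) (x : complexBetti (conjugateVariety σ X) k),
            (∀ i, complexBetti.map (conjHom σ (h i)) k x = 0) →
              complexBetti.map (conjHom σ w) k x = 0) →
          ∀ (p : ℕ) (ξ : complexBetti X (2 * p)), IsRationalClass ξ →
            IsOfHodgeType n X (2 * p) p p ξ →
            (∀ i, IsAbsoluteHodgeClass (m i) (Y i) p (complexBetti.map (h i) (2 * p) ξ)) →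
            IsAbsoluteHodgeClass nW W p (complexBetti.map w (2 * p) ξ) := by
  sorry

/-- STUB 2 (TOPOLOGY — theorem-candidate, attackable today, M/L) — **the fibre kernel inclusion.**
Why plausibly true: `f^σ : 𝒳^σ ⟶ C^σ` is again a surjection from a smooth projective variety onto a
smooth projective curve (`IsSmoothProjective.conjugateVariety_holds`; surjectivity is stable under base
change) and the `Y_i^σ` cover its fibre over `o^σ`; (a) Hodge III 8.2.7 on `𝒳^σ` (PROVED,
`Deligne1974_ker_pullback_eq_ker_pullback_resolution_holds`): `x` vanishes on an open `V ⊇ X_o^σ(ℂ)`;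
(b) tube: `f^σ(ℂ)` is proper hence closed, so `(f^σ)⁻¹(U) ⊆ V` for an open `U ∋ o^σ`, and `x|X_s = 0`
for `s ∈ U`; (c) over the smooth locus `C^σ_*` (Zariski open, cofinite, connected) restricted global
classes are flat sections (`FibreRestrictionsLocallyConstantRank`, Ehresmann
`ComplexPoints.isLocallyTrivialFibration_map`), so `{s ∈ C^σ_*(ℂ) | x|X_s = 0}` is clopen and
non-empty (`U` is infinite, `C^σ_*` cofinite), hence everything; (d) `t^σ ∈ C^σ_*` since `f` is flat
(integral source, regular curve) and `X_t` is smooth, and `(𝒳^σ)_{t^σ} ≅ (X_t)^σ` compatibly with the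
inclusions (`AlgPoints.map_fiberι_map_fiberOverMap`, `baseChangeHom` preserves pullbacks). Why it might
fail: none known mathematically (non-trivial Stein factorisation makes it vacuous); formal debts:
fibrewise smoothness criterion for flat morphisms, connectedness of a punctured `C(ℂ)`, the
conjugate-family bookkeeping. Size: L. [cite: DeligneHodgeIII1974, Prop. 8.2.7]
[cite: VoisinHodgeI2002, §9.2.1 and Thm. 9.3] [cite: Deligne1982HodgeCycles, §2 Thm. 2.12] -/
theorem stub_fibreKernelInclusion :
    ∀ ⦃N : ℕ⦄ ⦃𝒳 C : SchemeOver ℂ⦄ (f : 𝒳 ⟶ C) (o : AlgPoints C ℂ),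
      IsSmoothProjective N 𝒳 → IsSmoothProjective 1 C → Function.Surjective f.left.base →
      ∀ ⦃ι : Type⦄ [Finite ι] ⦃m : ι → ℕ⦄ ⦃Y : ι → SchemeOver ℂ⦄ (g : ∀ i, Y i ⟶ fiberOver f o),
        (∀ i, IsSmoothProjective (m i) (Y i)) →
        (∀ x : ↥(fiberOver f o).left, ∃ (i : ι) (y : ↥(Y i).left), (g i).left.base y = x) →
        ∀ (σ : ℂ ≃+* ℂ) (k : ℕ) (x : complexBetti (conjugateVariety σ 𝒳) k),
          (∀ i, complexBetti.map (conjHom σ (g i ≫ fiberι f o)) k x = 0) →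
          ∀ (t : AlgPoints C ℂ) ⦃n : ℕ⦄, IsSmoothProjective n (fiberOver f t) →
            complexBetti.map (conjHom σ (fiberι f t)) k x = 0 := by
  sorry

/-! ### Name-keyed aliases (skeleton-audit device of `Lines/birth.lean`) -/
namespace __Registered

/-- Alias of `KernelDescent` keyed by the registered stub name. -/
abbrev stub_kernelDescent : Prop := KernelDescent
/-- Alias of `FibreKernelInclusion` keyed by the registered stub name. -/
abbrev stub_fibreKernelInclusion : Prop := FibreKernelInclusion

end __Registered

/-! ### The composition: stub₁ → stub₂ → the crux, by name -/

/-- **THE LINE'S COMPOSITION** (pure logic, kernel-checked, no `sorry`): `stub_kernelDescent` at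
`X = 𝒳`, `h_i = g_i ≫ ι_o`, `w = ι_t`, with the kernel hypothesis supplied by
`stub_fibreKernelInclusion`. [cite: Deligne1982HodgeCycles, §2 Thm. 2.12] -/
theorem BoundaryAbsoluteness_of (h₁ : __Registered.stub_kernelDescent)
    (h₂ : __Registered.stub_fibreKernelInclusion) : BoundaryAbsoluteness := by
  intro N p 𝒳 C f o h𝒳 hC hf ι _ m Y g hY hcov ξ hξr hξh habs t n ht
  exact h₁ h𝒳 (fun i => g i ≫ fiberι f o) hY (fiberι f t) ht
    (fun σ k x hx => h₂ f o h𝒳 hC hf g hY hcov σ k x hx t ht) p ξ hξr hξh habs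

/-- **The crux, closed modulo exactly the two registered stubs.** -/
theorem BoundaryAbsoluteness_of_stubs : BoundaryAbsoluteness :=
  BoundaryAbsoluteness_of stub_kernelDescent stub_fibreKernelInclusion

end Summit.HodgeConjecture.HodgeConjecture.Cruxes.BoundaryAbsoluteness.KernelDescentLine

end
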